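import Summits.QuantumFields.YangMills.Theorems.BalabanUVNodesN16H7OfN07RecordSlot
import Summits.QuantumFields.BalabanUV.T4Continuum.Support.NE3EnergyRateFlatClass
import Summits.QuantumFields.BalabanUV.T4Continuum.Support.MinimalActionWitness
import HarnessLib

/-!
# Route «BalabanUVNodes» (K3⁷ `SpineGivenEndpointR13SepCoPH`, stmt-QuantumFields-20544), DAG node N16 = NE3, in-edge N07 → N16 — THE SLOT KEY, WHERE IT IS FREE:
# at the FLAT DATUM every (8)-class minimiser of every run is a periodic pure gauge, hence (9)–(10)-regular with ALL RADII `0` on EVERY cube of leaf-06's torus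
# instance at the shape `lipGauge`; so the re-keyed N07 in-edge (T9ˢ) ∧ (T8) holds on `{flatCfg}` hypothesis-free and its binder bundle is jointly inhabited there

Cell `pub-ymgap`, width seat `pub-ymgap-dag-n16-w1` (director-ym №197 ∕ HUMAN RULING D-0149), generation 5, file 11 of this lineage — the counterpart, for the slot key of
files 9∕9b∕10 (`…N16H7LooseOfReg910Slot[Family]`, `…N16H7OfN07RecordSlotKey`), of file 8 (`…N16CaptureWitnesses` p607179: CAPTURE, where it is free).
`--kind proof --supports stmt-QuantumFields-20544 --as helper` (count-neutral).  `bears_on: R4∕N16 · edge N07 → N16`.  THEOREMS ONLY (0 `def`, 0 `sorry`, standard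
axioms); everything BY NAME over landed modules: `NE3EnergyRateFlatClass.exists_periodic_gauge_of_isMinimiser_flatCfg` (zero action ⇒ zero curvature ⇒ `U = 1^{g}`),
`MinimalActionWitness.isMinimiser_sfClass_flatCfg`, this lineage's file 3 (`lipGauge`, `radiiMono_lipGauge'`, `interface_lipGauge'`).

THE SLOT KEY (file 9 §1, after dag-n16-w2's refutation p608145 of the all-cube torus reading): (T9ˢ) for every run `k+1`, every `0 < ε₁ ≤ a₁`, every datum
`V ∈ sfClass d L N ε₁ 0`, every minimiser `U` of the Wilson action over `sfClass d L N (B₃ε₁) (k+1)` at `V` and every site `x`, r2's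
`B11.Regularity (torusVP d L N G (k+1)) B₃ B₄ ε₁ U (x, L^{k+1} − 1 + L^{k+1} + 2)`; (T8) such a minimiser exists.  At non-flat loose data this is node N07's content
([Balaban1985Variational] Thm 1 (9)–(10) p. 279 at the (42)-objects) and is asserted nowhere.  THIS FILE: on the ONE datum `V = flatCfg` it is FREE.

WHAT THIS FILE PROVES (kernel).  §1 `lipGauge_gaugeAct_flatCfg` (a unitary pure gauge `1^{g}` lies in `lipGauge` on every cube with radii `0, 0, 0`: gauge it back by `g⁻¹`),
`regularity_torusVP_lipGauge_of_zero` (`lipGauge U y K 0 0 0` ⟹ `Regularity (torusVP d L N (lipGauge d n) k) B₃ B₄ ε₁ U (y, K)` for all `0 < B₃, B₄, ε₁`: the admissible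
common factor `t = 0` puts the infimum `Ψ` at `≤ 0`, strictly below each of the four printed M-proportional bounds, the Hölder slot included).  §2 ★
`regularity_of_isMinimiser_flatCfg` (every minimiser of run `k` over `sfClass d L N ε`, `ε ≥ 0`, at the flat datum is (9)–(10)-regular on EVERY cube `(y, K)` — not only the
slot cube, not only `M ≥ 1`), ★ `reg910Slot_on_flat` ((T9ˢ)'s text with the datum ranging over `{flatCfg}`, every `C : B11Thm1.Consts`), `exists8Min_on_flat` ((T8)'s text on
`{flatCfg}`).  §3 ★ `slotKey_bundle_on_flat` (for every `C`, the re-keyed bundle `(G, hGm, hG, (T9ˢ)|flat, (T8)|flat)` is inhabited by `G := lipGauge d n` — the A6 partial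
inhabitant of dag-n16-e's planned DischargeTest v6 `stub_reg910Slot`, cf. file 8 `leafH3sup_flatCfg` for the leaf).

HONEST FRAMING.  Hypothesis-free kernel facts about the TRIVIAL SECTOR (flat datum ⇒ zero action ⇒ pure gauge ⇒ radii `0`); they inhabit the CONCLUSION SHAPE of the re-keyed
in-edge where it is free and say NOTHING about non-flat loose data, which remain node N07's content; nothing of Bałaban asserted or refuted; `stub_h7` NOT closed; no stub
of K3⁷ v5 named or closed; N16 ∕ N07 NOT discharged; count-neutral; counts of record unmoved (typed 28∕28 · discharged 5∕28); one finite four-torus at fixed `ε`,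
Bałaban AS PRINTED — NOT ℝ⁴, NOT infinite volume, NOT OS, NOT a mass gap; the YM mass gap (Clay) is NOT proved by any of this — R4 closes the conditional finite-𝕋⁴ rung
`BalabanLadder.UV` only.
-/

set_option autoImplicit false

open scoped BigOperators Matrix Matrix.Norms.L2Operator
open NormedSpace

namespace Summit.QuantumFields.YangMills.BalabanUVNodes.N16SlotKeyWitnesses

open Literature.MathematicalPhysics.QuantumFieldTheory.Balaban1983to89
open B7Prop1Explicit B7Prop2Explicit MatrixLog UnitaryModel
open T4AveragingDeficitWall hiding Site Plane Plaq Bond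
open T4AveragingDeficitWallBoundary (IsPeriodicCfg)
open Summit.QuantumFields.BalabanUV.T4Continuum
open AveragingDeficitLatticeH2Prep (fd)
open MinimalActionSandwich (IsMinimiser)
open MinimalActionRate (sfClass)
open MinimalActionDictionary (torusVP RadiiMono cubeM cubeM_pos gaugeFactors gaugeInf)
open MinimalActionWitness (flatCfg flatCfg_mem_sfClass isMinimiser_sfClass_flatCfg)
open NE3EnergyRateFlatClass (exists_periodic_gauge_of_isMinimiser_flatCfg gaugeAct_inv_gaugeAct')
open B11 (Regularity)
open Summit.QuantumFields.YangMills.BalabanUVNodes.N16H7OfN07RecordSlot (lipGauge radiiMono_lipGauge' interface_lipGauge')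

noncomputable section

variable {d : ℕ} {n : Type} [Fintype n] [DecidableEq n]

/-! ## §1 Pure gauges are in `lipGauge` with radii `0`; radii `0` give r2's `Regularity` for the torus instance at every positive bound -/

/-- **A UNITARY PURE GAUGE OF `1` LIES IN THE (9)_{β₀=1} SUP SHAPE ON EVERY CUBE WITH ALL RADII `0`**: for `U = 1^{g}` (`gaugeAct g flatCfg`) with `g` unitary, the site
gauge `u := g⁻¹` gives `U^u = 1 = exp 0` on every bond (`gaugeAct_inv_gaugeAct'`), so `lipGauge d n U y K 0 0 0` with the potential `a := 0`. [folklore] -/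
theorem lipGauge_gaugeAct_flatCfg {g : Site d → (Matrix n n ℂ)ˣ} (hg : ∀ x, g x ∈ unitaryUnits (Matrix n n ℂ)) (y : Site d) (K : ℕ) :
    lipGauge d n (gaugeAct g (flatCfg : Site d → Fin d → (Matrix n n ℂ)ˣ)) y K 0 0 0 := by
  have hback : gaugeAct (fun z => (g z)⁻¹) (gaugeAct g (flatCfg : Site d → Fin d → (Matrix n n ℂ)ˣ)) = flatCfg :=
    gaugeAct_inv_gaugeAct' g flatCfg
  refine ⟨fun z => (g z)⁻¹, fun _ _ => 0, fun z => (unitaryUnits (Matrix n n ℂ)).inv_mem (hg z), fun z τ _ => ?_,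
    fun _ _ _ => by simp, fun _ _ _ _ => by simp [fd], fun _ _ _ _ _ => by simp [fd]⟩
  rw [hback]
  simp [flatCfg]

/-- **RADII `0` ⟹ r2's `Regularity` FOR THE TORUS INSTANCE AT THE SHAPE `lipGauge`, ON THAT CUBE, FOR ALL POSITIVE `B₃, B₄, ε₁`**: if `lipGauge d n U y K 0 0 0` then
`B11.Regularity (torusVP d L N (lipGauge d n) k) B₃ B₄ ε₁ U (y, K)` — the common factor `t = 0` is admissible, so `Gauged` holds and the infimum `Ψ = gaugeInf ≤ 0` is
strictly below each printed bound `B₃·M·ε₁·(L^jη)^{−1,−2,−3}` (all positive: `M = cubeM > 0`, `L^jη = 1` for the instance), while the instance's Hölder slot `holderA = 0`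
is below `B₄·M·ε₁·(L^jη)^{−(2+β)}`.  `L ≥ 1`. [cite: Balaban1985Variational, Thm 1 (9)–(10) p.279] -/
theorem regularity_torusVP_lipGauge_of_zero {L N k : ℕ} (hL : 1 ≤ L) {B₃ B₄ ε₁ : ℝ} (hB₃ : 0 < B₃) (hB₄ : 0 < B₄) (hε₁ : 0 < ε₁)
    {U : Site d → Fin d → (Matrix n n ℂ)ˣ} {y : Site d} {K : ℕ} (h : lipGauge d n U y K 0 0 0) :
    Regularity (torusVP d L N (lipGauge d n) k) B₃ B₄ ε₁ U (y, K) := by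
  have hL0 : 0 < L := by omega
  have hLr : (0 : ℝ) < (L : ℝ) := by exact_mod_cast hL0
  have hmem : (0 : ℝ) ∈ gaugeFactors (lipGauge d n) L k U y K := by
    refine ⟨le_rfl, ?_⟩
    simpa only [zero_div] using h
  have hinf : gaugeInf (lipGauge d n) L k U y K ≤ 0 := csInf_le ⟨0, fun t ht => ht.1⟩ hmem
  have hM : 0 < cubeM L k K := cubeM_pos hL k K
  have hx : (0 : ℝ) < ((L : ℝ) ^ k * (((L : ℝ) ^ k)⁻¹))⁻¹ := by positivity
  unfold Regularity
  dsimp only [torusVP]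
  refine ⟨⟨0, hmem⟩, hinf.trans_lt (by positivity), hinf.trans_lt (by positivity), fun β _ _ => ?_, hinf.trans_lt (by positivity)⟩
  have hr : (0 : ℝ) < (((L : ℝ) ^ k * (((L : ℝ) ^ k)⁻¹))⁻¹) ^ (2 + β) := Real.rpow_pos_of_pos hx _
  positivity

/-! ## §2 At the flat datum every (8)-class minimiser is (9)–(10)-regular on every cube; (T9ˢ) and (T8) on `{flatCfg}` -/

/-- **★ EVERY MINIMISER AT THE FLAT DATUM IS (9)–(10)-REGULAR ON EVERY CUBE.**  For `L, N ≥ 1`, `ε ≥ 0` and all `0 < B₃, B₄, ε₁`: every minimiser `U` of run `k` of the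
Wilson action over `sfClass d L N ε` at the datum `flatCfg` satisfies `B11.Regularity (torusVP d L N (lipGauge d n) k) B₃ B₄ ε₁ U (y, K)` for EVERY cube `(y, K)` — zero action
⇒ zero curvature ⇒ `U = 1^{g}` with `g` unitary periodic (`NE3EnergyRateFlatClass.exists_periodic_gauge_of_isMinimiser_flatCfg` BY NAME, the flat configuration being in
the class with action `0`), then §1.  Hypothesis-free; the trivial sector only. [folklore] -/
theorem regularity_of_isMinimiser_flatCfg [Nonempty n] {L N k : ℕ} (hL : 1 ≤ L) (hN : 1 ≤ N) {ε : ℝ} (hε : 0 ≤ ε)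
    {B₃ B₄ ε₁ : ℝ} (hB₃ : 0 < B₃) (hB₄ : 0 < B₄) (hε₁ : 0 < ε₁)
    {U : Site d → Fin d → (Matrix n n ℂ)ˣ} (hU : IsMinimiser d (sfClass d L N ε) L N k (flatCfg : Site d → Fin d → (Matrix n n ℂ)ˣ) U)
    (y : Site d) (K : ℕ) :
    Regularity (torusVP d L N (lipGauge d n) k) B₃ B₄ ε₁ U (y, K) := by
  obtain ⟨g, hg, -, hUg⟩ := exists_periodic_gauge_of_isMinimiser_flatCfg (𝒞 := sfClass d L N ε) hL hN
    (fun _ hV => ⟨hV.1, hV.2.1⟩) (flatCfg_mem_sfClass L N hε k) hU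
  refine regularity_torusVP_lipGauge_of_zero hL hB₃ hB₄ hε₁ ?_
  rw [hUg]
  exact lipGauge_gaugeAct_flatCfg hg y K

/-- **★ (T9ˢ) ON THE DATA SET `{flatCfg}`** — the slot key's regularity clause (file 9 §1's `hR`, binder for binder) with the datum quantifier ranging over the flat
configuration only, at the shape `lipGauge` and EVERY `C : B11Thm1.Consts`: for every run `k+1`, `0 < ε₁ ≤ a₁`, `V ∈ {flatCfg}`, every minimiser `U` over
`sfClass d L N (B₃ε₁) (k+1)` at `V` and every site `x`, `Regularity` on the collar-slot cube `(x, L^{k+1} − 1 + L^{k+1} + 2)`.  (The membership row `V ∈ sfClass d L N ε₁ 0`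
of (T9ˢ) holds too — `flatCfg_mem_sfClass` — and is not needed.)  `L, N ≥ 1`. [cite: Balaban1985Variational, Thm 1 (9)–(10) p.279] -/
theorem reg910Slot_on_flat [Nonempty n] {L N : ℕ} (hL : 1 ≤ L) (hN : 1 ≤ N) (C : B11Thm1.Consts) :
    ∀ (k : ℕ) (ε₁ : ℝ), 0 < ε₁ → ε₁ ≤ C.a₁ → ∀ (V U : Site d → Fin d → (Matrix n n ℂ)ˣ), V ∈ ({flatCfg} : Set (Site d → Fin d → (Matrix n n ℂ)ˣ)) →
      IsMinimiser d (sfClass d L N (C.B₃ * ε₁)) L N (k + 1) V U →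
        ∀ x : Site d, Regularity (torusVP d L N (lipGauge d n) (k + 1)) C.B₃ C.B₄ ε₁ U (x, L ^ (k + 1) - 1 + L ^ (k + 1) + 2) := by
  intro k ε₁ hε₁ _ V U hV hU x
  rw [Set.mem_singleton_iff] at hV
  subst hV
  exact regularity_of_isMinimiser_flatCfg hL hN (mul_nonneg C.B₃_pos.le hε₁.le) C.B₃_pos C.B₄_pos hε₁ hU x _

/-- **(T8) ON THE DATA SET `{flatCfg}`** — the slot key's existence clause (file 9 §1's `hE`) at the flat datum: the flat configuration itself minimises every run over
`sfClass d L N (B₃ε₁) (k+1)` (`MinimalActionWitness.isMinimiser_sfClass_flatCfg` BY NAME).  `L ≥ 1`. [cite: Balaban1985Variational, Thm 1 (8) p.279] -/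
theorem exists8Min_on_flat [Nonempty n] {L N : ℕ} (hL : 1 ≤ L) (C : B11Thm1.Consts) :
    ∀ (k : ℕ) (ε₁ : ℝ), 0 < ε₁ → ε₁ ≤ C.a₁ → ∀ V : Site d → Fin d → (Matrix n n ℂ)ˣ, V ∈ ({flatCfg} : Set (Site d → Fin d → (Matrix n n ℂ)ˣ)) →
      ∃ U : Site d → Fin d → (Matrix n n ℂ)ˣ, IsMinimiser d (sfClass d L N (C.B₃ * ε₁)) L N (k + 1) V U := by
  intro k ε₁ hε₁ _ V hV
  rw [Set.mem_singleton_iff] at hV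
  subst hV
  exact ⟨flatCfg, isMinimiser_sfClass_flatCfg hL N (mul_nonneg C.B₃_pos.le hε₁.le) (k + 1)⟩

/-! ## §3 The re-keyed binder bundle is jointly inhabited on the flat datum (A6 partial inhabitant) -/

/-- **★ THE RE-KEYED N07 IN-EDGE BUNDLE, RESTRICTED TO THE FLAT DATUM, IS INHABITED** (every `C : B11Thm1.Consts`; `L, N ≥ 1`): the local-gauge shape `G := lipGauge d n` is
monotone in its radii (`hGm`), meets the (9)_{β₀=1} interface (`hG`), and satisfies (T9ˢ) and (T8) with the datum ranging over `{flatCfg}` — so dag-n16-w2's rank-two refutation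
of the OLD bundle (`∀ k, Thm1At C (torusVP …)`, p608145: small cubes against a NON-flat constant datum) has no flat-sector analogue for the NEW one, and the only open
content of the re-keyed in-edge is the non-flat loose data (node N07).  Cf. file 8 `leafH3sup_flatCfg` (the leaf itself on `{flatCfg}`). [folklore] -/
theorem slotKey_bundle_on_flat [Nonempty n] {L N : ℕ} (hL : 1 ≤ L) (hN : 1 ≤ N) (C : B11Thm1.Consts) :
    ∃ G : (Site d → Fin d → (Matrix n n ℂ)ˣ) → Site d → ℕ → ℝ → ℝ → ℝ → Prop,
      RadiiMono d G ∧
      (∀ (U : Site d → Fin d → (Matrix n n ℂ)ˣ) (x : Site d) (K : ℕ) (α₀ α₁ α₂ : ℝ), 2 ≤ K → G U x K α₀ α₁ α₂ →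
        ∃ (u : Site d → (Matrix n n ℂ)ˣ) (a : Site d → Fin d → Matrix n n ℂ),
          (∀ z, u z ∈ unitaryUnits (Matrix n n ℂ)) ∧
          (∀ (y : Site d) (τ : Fin d), l1 (y - x) ≤ 2 → ((gaugeAct u U y τ : (Matrix n n ℂ)ˣ) : Matrix n n ℂ) = exp (a y τ)) ∧
          (∀ (y : Site d) (τ : Fin d), l1 (y - x) ≤ 2 → ‖a y τ‖ ≤ α₀) ∧
          (∀ (y : Site d) (τ i : Fin d), l1 (y - x) ≤ 1 → ‖fd i (fun z => a z τ) y‖ ≤ α₁) ∧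
          (∀ (τ i l : Fin d), ‖fd i (fd l (fun z => a z τ)) x‖ ≤ α₂)) ∧
      (∀ (k : ℕ) (ε₁ : ℝ), 0 < ε₁ → ε₁ ≤ C.a₁ → ∀ (V U : Site d → Fin d → (Matrix n n ℂ)ˣ), V ∈ ({flatCfg} : Set (Site d → Fin d → (Matrix n n ℂ)ˣ)) →
        IsMinimiser d (sfClass d L N (C.B₃ * ε₁)) L N (k + 1) V U →
          ∀ x : Site d, Regularity (torusVP d L N G (k + 1)) C.B₃ C.B₄ ε₁ U (x, L ^ (k + 1) - 1 + L ^ (k + 1) + 2)) ∧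
      (∀ (k : ℕ) (ε₁ : ℝ), 0 < ε₁ → ε₁ ≤ C.a₁ → ∀ V : Site d → Fin d → (Matrix n n ℂ)ˣ, V ∈ ({flatCfg} : Set (Site d → Fin d → (Matrix n n ℂ)ˣ)) →
        ∃ U : Site d → Fin d → (Matrix n n ℂ)ˣ, IsMinimiser d (sfClass d L N (C.B₃ * ε₁)) L N (k + 1) V U) :=
  ⟨lipGauge d n, radiiMono_lipGauge', fun U x K α₀ α₁ α₂ hK hG => interface_lipGauge' U x K α₀ α₁ α₂ hK hG,
    reg910Slot_on_flat hL hN C, exists8Min_on_flat hL C⟩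

end

end Summit.QuantumFields.YangMills.BalabanUVNodes.N16SlotKeyWitnesses
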